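/-
Copyright: cell `pub-balaban-gaps` (G2), seat ne6 (row NE7b), `prover-pub-balaban-gaps-ne6-g16-0`. Project licence.
-/
import Summits.QuantumFields.BalabanUV.T4Continuum.Spine.NE7b.CompactFibreWindowSU2Explicit
import Summits.QuantumFields.BalabanUV.T4Continuum.Spine.NE7b.CompactFibrePlaquetteMassSUN

/-!
# Census V43: THE SU(2) FIBRE BY VALUE IN THE TWO TREE CURRENCIES — the OWNER's `linkMass` ∕ bare torus partition function
# (`e⁻¹∕8·(β∕2)^{−3∕2} ≤ linkMass β ≤ (π²√π∕16)·(β∕2)^{−3∕2}`, `Z_K(β) ≤ ((π²√π∕16)·(β∕2)^{−3∕2})^{2·L^{m+K}}`) and V29's Hilbert–Schmidt ball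
# (`η³∕(16√2) ≤ Haar_{SU(2)}{‖V − 1‖_HS ≤ η} ≤ η³∕(3√2·π)`, `0 < η ≤ 2√2`), plus the one-plaquette free energy `|−log Z(β) − (3∕2)log β| ≤ 1 + log 8`
# (row NE7b, node U5c; MODEL, [folklore])

Cell `pub-balaban-gaps` (G2 spine census) for the `pub-balaban` T⁴ crux NE7b (NOT PRINTED, NOT PROVED).  V39 (`CompactFibrePlaquetteMassSUN` §4) turned the owner
lineage's qualitative «no K-uniform floor under the bare Wilson partition function» into a decay at print's rate with a SOFT constant (`exists_linkMass_SU_le`,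
`partitionFn_T4_le_rate`: `∃ C′`).  For `SU(2)` V41 printed the one-plaquette constants; this file carries them into the owner's currency
(`GaugeGroup.reTr = Re Tr∕N`, so `linkMass β = ∫e^{−(β∕2)·Re tr(1−V)} dHaar_{SU(2)}` by V39's `linkMass_SU_eq`): a two-sided bracket for `linkMass` and an explicit,
`K`-free-constant ceiling for `Z_K(β)` on Bałaban's `K`-th torus, every `K`, every `β > 0` (§1).  §2 reads V41's floor and V42's ceiling for the trace
window in V29's Hilbert–Schmidt currency (`{Re tr(1 − V) ≤ t} = {‖V − 1‖_HS ≤ √(2t)}`, `CompactFibreWindowSUNRate.traceWindow_eq_sball`):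
V29's `exists_haarReal_sball_two_sided` (`∃ C ≥ 1`, every `N`) for `N = 2` WITH THE CONSTANT PRINTED, `[1∕(16√2), 1∕(3√2·π)]·η³ = [0.0442, 0.0750]·η³`.
§3 takes logarithms in V41's bracket: V39's `exists_abs_neg_log_plaquetteMass_sub_le` (`∃ c₁`) for `N = 2` with `c₁ = 1 + log 8 = 3.079…` printed (`β ≥ 1∕4`).
No `def`, zero `sorry`, nothing of Bałaban's asserted.  BY-NAME EFFECT ON THE WALL: NONE.
HONEST DEPENDENCY: continuum YM on T⁴ ⇐ BetaPertH ∧ nine spine estimates (0/9 proved); BetaPertH ⇐ (D1) ∧ (D4) ∧ CAP+tail;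
G-an2-4 gates asym, D1 and NE2/3/4.  This file changes none of it.
-/

set_option autoImplicit false

noncomputable section

open MeasureTheory Real Set
open Literature.MathematicalPhysics.QuantumFieldTheory (haarProbability)
open Literature.MathematicalPhysics.QuantumFieldTheory.Balaban1983to89
open Literature.MathematicalPhysics.QuantumFieldTheory.Balaban1983to89.Missing (partitionFn)
open Literature.MathematicalPhysics.QuantumFieldTheory.Balaban1983to89.T4Continuum (T4Family)
open Summit.QuantumFields.BalabanUV.T4Continuum.NE7b.BarePartitionFnDecay (linkMass linkMass_nonneg)
open Summit.QuantumFields.BalabanUV.T4Continuum.NE7b.BarePartitionFnNoFloor (partitionFn_T4_le)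
open Summit.QuantumFields.BalabanUV.T4Continuum.NE7b.CompactFibrePlaquetteMassSUN (linkMass_SU_eq)
open Summit.QuantumFields.BalabanUV.T4Continuum.NE7b.CompactFibrePlaquetteMassSU2Explicit (explicit_le_plaquetteMass_SU2 plaquetteMass_SU2_le_explicit)

namespace Summit.QuantumFields.BalabanUV.T4Continuum.NE7b.CompactFibreLinkMassSU2Explicit

/-! ## §1 The OWNER's currency -/

/-- **THE OWNER's SINGLE-PLAQUETTE MASS ON `SU(2)` FROM ABOVE, BY VALUE**: `linkMass β ≤ (π²√π∕16)·((√(β∕2))⁻¹)³` for every `β > 0`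
(V39's `exists_linkMass_SU_le` for `N = 2` with the constant printed and no threshold `β ≥ N`). [folklore] -/
theorem linkMass_SU2_le_explicit {β : ℝ} (hβ : 0 < β) :
    linkMass (G := Matrix.specialUnitaryGroup (Fin 2) ℂ) β ≤ Real.pi ^ 2 * Real.sqrt Real.pi / 16 * (Real.sqrt (β / 2))⁻¹ ^ 3 := by
  rw [linkMass_SU_eq]
  exact plaquetteMass_SU2_le_explicit (β := β / 2) (by positivity)

/-- **THE OWNER's SINGLE-PLAQUETTE MASS ON `SU(2)` FROM BELOW, BY VALUE**: `e⁻¹∕8·((√(β∕2))⁻¹)³ ≤ linkMass β` for `β ≥ 1∕2`. [folklore] -/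
theorem explicit_le_linkMass_SU2 {β : ℝ} (hβ : 1 / 2 ≤ β) :
    (Real.exp 1)⁻¹ / 8 * (Real.sqrt (β / 2))⁻¹ ^ 3 ≤ linkMass (G := Matrix.specialUnitaryGroup (Fin 2) ℂ) β := by
  rw [linkMass_SU_eq]
  exact explicit_le_plaquetteMass_SU2 (β := β / 2) (by linarith)

variable {F : T4Family}

/-- **F-ne7bp1-g103-2 BY VALUE FOR `SU(2)`**: the bare Wilson partition function of Bałaban's `K`-th torus with gauge group `SU(2)` satisfies
`Z_K(β) ≤ ((π²√π∕16)·((√(β∕2))⁻¹)³)^{2·L^{m+K}}` for EVERY `K` and EVERY `β > 0` (the owner's `partitionFn_T4_le` with `linkMass_SU2_le_explicit`;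
V39's `partitionFn_T4_le_rate` for `N = 2` with the constant printed).  The base is `< 1` as soon as `β > 2·(π²√π∕16)^{2∕3} = 2.12…`. [folklore] -/
theorem partitionFn_T4_SU2_le_explicit (K : ℕ) {β : ℝ} (hβ : 0 < β) :
    partitionFn (G := Matrix.specialUnitaryGroup (Fin 2) ℂ) (F.P K) β
      ≤ (Real.pi ^ 2 * Real.sqrt Real.pi / 16 * (Real.sqrt (β / 2))⁻¹ ^ 3) ^ (2 * F.L ^ (F.m + K)) :=
  (partitionFn_T4_le K hβ.le).trans (pow_le_pow_left₀ (linkMass_nonneg β) (linkMass_SU2_le_explicit hβ) _)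

/-! ## §2 V29's Hilbert–Schmidt ball of `SU(2)` by value -/

section HS

open scoped Matrix.Norms.Frobenius

/-- **V29's TWO-SIDED SMALL-BALL LAW FOR `SU(2)` WITH THE CONSTANT PRINTED**: for `0 < η ≤ 2√2`,
`η³∕(16√2) ≤ Haar_{SU(2)}{‖V − 1‖_HS ≤ η} ≤ η³∕(3√2·π)` (`{‖V − 1‖_HS ≤ η} = {Re tr(1 − V) ≤ η²∕2}`; V41's floor and V42's ceiling at `t = η²∕2`;
the ceiling constant is the small-`η` limit). [folklore] -/
theorem haarReal_sball_SU2_mem_Icc {η : ℝ} (hη0 : 0 < η) (hη : η ≤ 2 * Real.sqrt 2) :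
    (haarProbability (Matrix.specialUnitaryGroup (Fin 2) ℂ)).real
        {V : Matrix.specialUnitaryGroup (Fin 2) ℂ | ‖(V : Matrix (Fin 2) (Fin 2) ℂ) - 1‖ ≤ η}
      ∈ Set.Icc (η ^ 3 / (16 * Real.sqrt 2)) (η ^ 3 / (3 * Real.sqrt 2 * Real.pi)) := by
  have h2 : 0 < Real.sqrt 2 := Real.sqrt_pos.2 two_pos
  have hs2 : Real.sqrt 2 ^ 2 = 2 := Real.sq_sqrt two_pos.le
  have ht0 : 0 < η ^ 2 / 2 := by positivity
  have ht4 : η ^ 2 / 2 ≤ 4 := by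
    rw [div_le_iff₀ two_pos]; nlinarith [hs2, hη, hη0]
  have hsqrt2t : Real.sqrt (2 * (η ^ 2 / 2)) = η := by
    rw [mul_div_cancel₀ _ two_ne_zero, Real.sqrt_sq hη0.le]
  have hsqt : Real.sqrt (η ^ 2 / 2) = η / Real.sqrt 2 := by
    rw [Real.sqrt_div' _ zero_le_two, Real.sqrt_sq hη0.le]
  have hwin := CompactFibreWindowSU2Explicit.haarReal_traceWindow_mem_Icc ht0 ht4
  rw [CompactFibreWindowSUNRate.traceWindow_eq_sball ht0.le, hsqrt2t, hsqt] at hwin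
  have hs3 : Real.sqrt 2 ^ 3 = 2 * Real.sqrt 2 := by rw [pow_succ, hs2]
  have e1 : (η / Real.sqrt 2) ^ 3 / 8 = η ^ 3 / (16 * Real.sqrt 2) := by
    rw [div_pow, hs3]; field_simp; ring
  have e2 : 2 / (3 * Real.pi) * (η / Real.sqrt 2) ^ 3 = η ^ 3 / (3 * Real.sqrt 2 * Real.pi) := by
    rw [div_pow, hs3]; field_simp
  rw [e1, e2] at hwin
  exact hwin

/-- **V29's SMALL-BALL CEILING FOR `SU(2)` BY VALUE, ALL RADII**: `Haar_{SU(2)}{‖V − 1‖_HS ≤ η} ≤ η³∕(3√2·π)` for every `η ≥ 0`. [folklore] -/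
theorem haarReal_sball_SU2_le_explicit {η : ℝ} (hη : 0 ≤ η) :
    (haarProbability (Matrix.specialUnitaryGroup (Fin 2) ℂ)).real
        {V : Matrix.specialUnitaryGroup (Fin 2) ℂ | ‖(V : Matrix (Fin 2) (Fin 2) ℂ) - 1‖ ≤ η} ≤ η ^ 3 / (3 * Real.sqrt 2 * Real.pi) := by
  have h2 : 0 < Real.sqrt 2 := Real.sqrt_pos.2 two_pos
  have hs2 : Real.sqrt 2 ^ 2 = 2 := Real.sq_sqrt two_pos.le
  have hsqrt2t : Real.sqrt (2 * (η ^ 2 / 2)) = η := by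
    rw [mul_div_cancel₀ _ two_ne_zero, Real.sqrt_sq hη]
  have hsqt : Real.sqrt (η ^ 2 / 2) = η / Real.sqrt 2 := by
    rw [Real.sqrt_div' _ zero_le_two, Real.sqrt_sq hη]
  have hwin := CompactFibreWindowSU2Explicit.haarReal_traceWindow_le_explicit (t := η ^ 2 / 2) (by positivity)
  rw [CompactFibreWindowSUNRate.traceWindow_eq_sball (by positivity), hsqrt2t, hsqt] at hwin
  have hs3 : Real.sqrt 2 ^ 3 = 2 * Real.sqrt 2 := by rw [pow_succ, hs2]
  have e2 : 2 / (3 * Real.pi) * (η / Real.sqrt 2) ^ 3 = η ^ 3 / (3 * Real.sqrt 2 * Real.pi) := by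
    rw [div_pow, hs3]; field_simp
  rw [e2] at hwin
  exact hwin

end HS


/-! ## §3 The one-plaquette free energy of `SU(2)` by value -/

/-- **THE ONE-PLAQUETTE FREE ENERGY OF `SU(2)` BY VALUE**: for `β ≥ 1∕4`,
`|−log ∫e^{−β·Re tr(1−V)} dHaar_{SU(2)} − (3∕2)·log β| ≤ 1 + log 8` — V39's `exists_abs_neg_log_plaquetteMass_sub_le` (`∃ c₁`) for `N = 2`
with the constant printed (`1 + log 8 = 3.079…`; the refuter's instrument 7′ reads the true `c₁` near `log(2√π) = 1.2655` asymptotically). [folklore] -/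
theorem abs_neg_log_plaquetteMass_SU2_sub_le {β : ℝ} (hβ : 1 / 4 ≤ β) :
    |-Real.log (∫ U, Real.exp (-(β * (Matrix.trace (1 - (U : Matrix (Fin 2) (Fin 2) ℂ))).re)) ∂(haarProbability (Matrix.specialUnitaryGroup (Fin 2) ℂ)))
        - 3 / 2 * Real.log β| ≤ 1 + Real.log 8 := by
  have hβ0 : 0 < β := by linarith
  set Z := ∫ U, Real.exp (-(β * (Matrix.trace (1 - (U : Matrix (Fin 2) (Fin 2) ℂ))).re)) ∂(haarProbability (Matrix.specialUnitaryGroup (Fin 2) ℂ)) with hZ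
  have hlo := explicit_le_plaquetteMass_SU2 hβ
  have hup := plaquetteMass_SU2_le_explicit hβ0
  rw [← hZ] at hlo hup
  have hu : 0 < (Real.sqrt β)⁻¹ ^ 3 := by positivity
  have hc : 0 < (Real.exp 1)⁻¹ / 8 := by positivity
  have hZpos : 0 < Z := lt_of_lt_of_le (mul_pos hc hu) hlo
  -- `log ((√β)⁻¹ ^ 3) = −(3∕2)·log β`
  have hlogu : Real.log ((Real.sqrt β)⁻¹ ^ 3) = -(3 / 2 * Real.log β) := by
    rw [Real.log_pow, Real.log_inv, Real.log_sqrt hβ0.le]; push_cast; ring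
  -- lower bound on `Z` ⇒ upper bound on `−log Z − (3∕2) log β`
  have h1 : Real.log ((Real.exp 1)⁻¹ / 8 * (Real.sqrt β)⁻¹ ^ 3) ≤ Real.log Z := Real.log_le_log (mul_pos hc hu) hlo
  rw [Real.log_mul hc.ne' hu.ne', hlogu, Real.log_div (by positivity) (by norm_num), Real.log_inv, Real.log_exp] at h1
  -- upper bound on `Z` ⇒ lower bound
  have hC : 0 < Real.pi ^ 2 * Real.sqrt Real.pi / 16 := by positivity
  have h2 : Real.log Z ≤ Real.log (Real.pi ^ 2 * Real.sqrt Real.pi / 16 * (Real.sqrt β)⁻¹ ^ 3) := Real.log_le_log hZpos hup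
  rw [Real.log_mul hC.ne' hu.ne', hlogu] at h2
  -- `log(π²√π∕16) ≤ log 8 ≤ 1 + log 8` (crudely: `π ≤ 4`, `√π ≤ 2`)
  have hπ4 : Real.pi ≤ 4 := Real.pi_le_four
  have hsπ2 : Real.sqrt Real.pi ≤ 2 := by
    rw [show (2:ℝ) = Real.sqrt (2 ^ 2) by rw [Real.sqrt_sq (by norm_num : (0:ℝ) ≤ 2)]]; exact Real.sqrt_le_sqrt (by linarith)
  have hChi : Real.pi ^ 2 * Real.sqrt Real.pi / 16 ≤ 8 := by
    rw [div_le_iff₀ (by norm_num : (0:ℝ) < 16)]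
    nlinarith [Real.pi_pos, Real.sqrt_nonneg Real.pi, mul_le_mul hπ4 hπ4 Real.pi_pos.le (by norm_num : (0:ℝ) ≤ 4)]
  have hlogC8 : Real.log (Real.pi ^ 2 * Real.sqrt Real.pi / 16) ≤ Real.log 8 := Real.log_le_log hC hChi
  have hlog8 : 0 ≤ Real.log 8 := Real.log_nonneg (by norm_num)
  rw [abs_le]
  constructor <;> linarith

end Summit.QuantumFields.BalabanUV.T4Continuum.NE7b.CompactFibreLinkMassSU2Explicit

end
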